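import Summits.NavierStokesRegularity.NavierStokesRegularity.Theorems.FilamentSkeletonRssCoreLinearInvertibilityRadialBlockToolsB

/-!
# Even sector of crux `CoreLinearInvertibility` (stmt-NavierStokesRegularity-17973), line `Sketch`:
# the radial block with a divergence-form source — part A, one-variable variants

The radial equation of the even sector reads `L w₀ = f₀ − λ (4r)⁻¹ (r² c₂)′` (`c₂` the `cos 2θ`
coefficient of the non-radial part). The derivative in the coupling source is removed by the radial
CORRECTOR `Z` solving `LZ = λ(4r)⁻¹(r²c₂)′` in the mass-zero normalisation; `W − Z` then has the flux
`J₁` with `J₁′ = r f₀`, but is no longer compactly supported (Gaussian tail) — it only satisfies the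
CENTRE IDENTITY `W(0) = −∫₀ᵇ (W′ + (r/2)W)`. This file provides the variants of the one-variable radial
tools (`…RadialBlockToolsA/B`) with exactly that hypothesis:

* `radial_center_sq_le_of_center` — the centre bound from the centre identity;
* `radial_far_le'` — the far-field moments WITHOUT `W(b) = 0` (the boundary term at `b` is `≥ 0`);
* `radial_profile_bound_of_center` — the assembled bound
  `∫₀ᵇ e^{βr²/4}((1 + r²)W² + r²W₁²) r ≤ (3·10⁵e¹²/β²) ∫₀ᵇ e^{βr²/4} F² r` under `J(b) = 0` and the
  centre identity (proofs verbatim from the tools, with the two hypotheses swapped in).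
-/

set_option linter.dupNamespace false

noncomputable section

namespace Summit.NavierStokesRegularity.NavierStokesRegularity.Theorems

open MeasureTheory Filter Topology Set intervalIntegral

/-- **The centre value from the centre identity** (variant of `radial_center_sq_le` in which the
consequence `W(0) = −∫₀ᵇ (W₁ + (r/2)W)` of zero mass and `W(b) = 0` is the HYPOTHESIS, so that profiles with
a Gaussian tail are admitted): if moreover `J = rW₁ + (r²/2)W` obeys `J² ≤ (r²/2) N` on `[0, b]` (`b ≥ 1`),
then `W(0)² ≤ N + 2 ∫₀ᵇ e^{βr²/4} J² r` (split at `r = 1`; Cauchy–Schwarz). [folklore] -/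
theorem radial_center_sq_le_of_center {β b N : ℝ} (hβ : 0 ≤ β) (hb : 1 ≤ b) {W W₁ J : ℝ → ℝ}
    (hW : ∀ r, HasDerivAt W (W₁ r) r) (hW₁c : Continuous W₁) (hJc : Continuous J)
    (hJ : ∀ r, J r = r * W₁ r + r ^ 2 / 2 * W r)
    (hJsq : ∀ r ∈ Icc 0 b, J r ^ 2 ≤ r ^ 2 / 2 * N)
    (h0 : W 0 = -∫ r in 0..b, (W₁ r + r / 2 * W r)) :
    W 0 ^ 2 ≤ N + 2 * ∫ r in 0..b, Real.exp (β / 4 * r ^ 2) * J r ^ 2 * r := by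
  have hb0 : (0 : ℝ) ≤ b := zero_le_one.trans hb
  have hEc : Continuous fun s : ℝ => Real.exp (β / 4 * s ^ 2) :=
    Real.continuous_exp.comp (continuous_const.mul (continuous_id.pow 2))
  have hWc : Continuous W := continuous_iff_continuousAt.2 fun r => (hW r).continuousAt
  set q : ℝ → ℝ := fun r => W₁ r + r / 2 * W r with hq
  have hqc : Continuous q := hW₁c.add ((continuous_id.div_const 2).mul hWc)
  -- `W 0 = -∫ q` is the hypothesis
  have h0' : W 0 = -∫ r in 0..b, q r := h0
  have hsplit : ∫ r in 0..b, q r = (∫ r in 0..1, q r) + ∫ r in 1..b, q r :=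
    (intervalIntegral.integral_add_adjacent_intervals (hqc.intervalIntegrable _ _)
      (hqc.intervalIntegrable _ _)).symm
  have hq_sq : ∀ r ∈ Ioo 0 b, q r ^ 2 ≤ N / 2 := by
    intro r hr
    have hJr : J r = r * q r := by rw [hJ]; simp only [hq]; ring
    have h := hJsq r ⟨hr.1.le, hr.2.le⟩
    rw [hJr, mul_pow] at h
    have hr2 : 0 < r ^ 2 := by have := hr.1; positivity
    exact le_of_mul_le_mul_left (by linarith) hr2
  -- near part `[0, 1]`
  have hI1 : (∫ r in 0..1, q r) ^ 2 ≤ N / 2 := by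
    have hcs := sq_intervalIntegral_mul_le zero_le_one (f := fun _ => (1 : ℝ)) (g := q)
      intervalIntegrable_const ((hqc.pow 2).intervalIntegrable _ _)
      ((continuous_const.mul hqc).intervalIntegrable _ _)
    have h1c : ∫ r in (0 : ℝ)..1, (fun _ => (1 : ℝ)) r ^ 2 = 1 := by simp
    have h1m : ∫ r in (0 : ℝ)..1, (fun _ => (1 : ℝ)) r * q r = ∫ r in (0 : ℝ)..1, q r :=
      intervalIntegral.integral_congr fun r _ => one_mul _
    rw [h1c, h1m, one_mul] at hcs
    have h2 : ∫ r in 0..1, q r ^ 2 ≤ ∫ r in (0 : ℝ)..1, N / 2 :=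
      intervalIntegral.integral_mono_on_of_le_Ioo zero_le_one ((hqc.pow 2).intervalIntegrable _ _)
        intervalIntegrable_const fun r hr => hq_sq r ⟨hr.1, hr.2.trans_le hb⟩
    rw [intervalIntegral.integral_const, sub_zero, smul_eq_mul, one_mul] at h2
    exact hcs.trans h2
  -- far part `[1, b]`
  have hI2 : (∫ r in 1..b, q r) ^ 2 ≤ ∫ r in 0..b, Real.exp (β / 4 * r ^ 2) * J r ^ 2 * r := by
    have e1 : ∫ r in 1..b, q r = ∫ r in 1..b, J r * r⁻¹ := by
      refine intervalIntegral.integral_congr fun r hr => ?_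
      rw [uIcc_of_le hb] at hr
      have hr0 : r ≠ 0 := (zero_lt_one.trans_le hr.1).ne'
      show q r = J r * r⁻¹
      rw [hJ]
      simp only [hq]
      field_simp
    have hinv_c : ContinuousOn (fun r : ℝ => r⁻¹) (uIcc 1 b) := by
      rw [uIcc_of_le hb]
      exact continuousOn_inv₀.mono fun r hr => (zero_lt_one.trans_le hr.1).ne'
    have hinv2_c : ContinuousOn (fun r : ℝ => r⁻¹ ^ 2) (uIcc 1 b) := hinv_c.pow 2
    have hcs := sq_intervalIntegral_mul_le hb (f := J) (g := fun r => r⁻¹)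
      ((hJc.pow 2).intervalIntegrable _ _) hinv2_c.intervalIntegrable
      (hJc.continuousOn.mul hinv_c).intervalIntegrable
    have hi : ∫ r in 1..b, r⁻¹ ^ 2 ≤ 1 := by
      have hd : ∀ r ∈ uIcc 1 b, HasDerivAt (fun s : ℝ => -s⁻¹) (r⁻¹ ^ 2) r := by
        intro r hr
        rw [uIcc_of_le hb] at hr
        have hr0 : r ≠ 0 := (zero_lt_one.trans_le hr.1).ne'
        simpa [inv_pow] using (hasDerivAt_inv hr0).fun_neg
      rw [integral_eq_sub_of_hasDerivAt hd hinv2_c.intervalIntegrable]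
      have : 0 ≤ b⁻¹ := inv_nonneg.2 hb0
      simp only [inv_one]
      linarith
    have hJ2 : ∫ r in 1..b, J r ^ 2 ≤ ∫ r in 0..b, Real.exp (β / 4 * r ^ 2) * J r ^ 2 * r := by
      calc ∫ r in 1..b, J r ^ 2 ≤ ∫ r in 1..b, Real.exp (β / 4 * r ^ 2) * J r ^ 2 * r := by
            refine intervalIntegral.integral_mono_on hb ((hJc.pow 2).intervalIntegrable _ _)
              (((hEc.mul (hJc.pow 2)).mul continuous_id).intervalIntegrable _ _) fun r hr => ?_
            have h1 : (1 : ℝ) ≤ Real.exp (β / 4 * r ^ 2) := Real.one_le_exp (by positivity)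
            have h1' : (1 : ℝ) ≤ Real.exp (β / 4 * r ^ 2) * r := by nlinarith [hr.1]
            nlinarith [sq_nonneg (J r)]
        _ ≤ ∫ r in 0..b, Real.exp (β / 4 * r ^ 2) * J r ^ 2 * r := by
            refine intervalIntegral.integral_mono_interval zero_le_one hb le_rfl ?_
              (((hEc.mul (hJc.pow 2)).mul continuous_id).intervalIntegrable _ _)
            filter_upwards [ae_restrict_mem measurableSet_Ioc] with s hs
            exact mul_nonneg (mul_nonneg (Real.exp_pos _).le (sq_nonneg _)) hs.1.le
    have h0' : 0 ≤ ∫ r in 1..b, J r ^ 2 := intervalIntegral.integral_nonneg hb fun r _ => sq_nonneg _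
    calc (∫ r in 1..b, q r) ^ 2 = (∫ r in 1..b, J r * r⁻¹) ^ 2 := by rw [e1]
      _ ≤ (∫ r in 1..b, J r ^ 2) * ∫ r in 1..b, r⁻¹ ^ 2 := hcs
      _ ≤ (∫ r in 1..b, J r ^ 2) * 1 := mul_le_mul_of_nonneg_left hi h0'
      _ ≤ _ := by rw [mul_one]; exact hJ2
  rw [h0', hsplit]
  nlinarith [hI1, hI2, sq_nonneg ((∫ r in 0..1, q r) - ∫ r in 1..b, q r)]



/-- **Far-field weighted moments, no boundary condition at `b`** (variant of `radial_far_le`): for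
`W' = W₁`, `J = rW₁ + (r²/2)W`, `b ≥ 4`, `β ≤ 1`, `k ≤ 2`,
`∫₄ᵇ e^{βr²/4} W² r^{2k+1} ≤ 8 e⁴ 4^{2k} W(4)² + 64 ∫₀ᵇ e^{βr²/4} J² r`
(the boundary term `e^{βb²/4} W(b)² b^{2k}` of the fundamental theorem of calculus is nonnegative and is
simply dropped). [folklore] -/
theorem radial_far_le' {β b NJ M2 : ℝ} (hβ1 : β ≤ 1) (hb : 4 ≤ b) {W W₁ J : ℝ → ℝ}
    (hW : ∀ r, HasDerivAt W (W₁ r) r) (hW₁c : Continuous W₁) (hJc : Continuous J)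
    (hJ : ∀ r, J r = r * W₁ r + r ^ 2 / 2 * W r)
    (hNJ : ∫ r in 0..b, Real.exp (β / 4 * r ^ 2) * J r ^ 2 * r ≤ NJ)
    (hM : W 4 ^ 2 ≤ M2) {k : ℕ} (hk : k ≤ 2) :
    ∫ r in 4..b, Real.exp (β / 4 * r ^ 2) * W r ^ 2 * r ^ (2 * k + 1) ≤
      8 * Real.exp 4 * 4 ^ (2 * k) * M2 + 64 * NJ := by
  have hWc : Continuous W := continuous_iff_continuousAt.2 fun r => (hW r).continuousAt
  have hEc : Continuous fun r : ℝ => Real.exp (β / 4 * r ^ 2) :=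
    Real.continuous_exp.comp (continuous_const.mul (continuous_id.pow 2))
  set Φ' : ℝ → ℝ := fun r => 2 * (β / 4) * r * Real.exp (β / 4 * r ^ 2) * W r ^ 2 * r ^ (2 * k) +
      Real.exp (β / 4 * r ^ 2) * (2 * W r * W₁ r) * r ^ (2 * k) +
      Real.exp (β / 4 * r ^ 2) * W r ^ 2 * (((2 * k : ℕ) : ℝ) * r ^ (2 * k - 1)) with hΦ'
  have hΦ : ∀ r, HasDerivAt (fun s => Real.exp (β / 4 * s ^ 2) * W s ^ 2 * s ^ (2 * k)) (Φ' r) r := by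
    intro r
    have h2 : HasDerivAt (fun s => W s ^ 2) (2 * W r * W₁ r) r := by
      simpa using (hW r).fun_pow 2
    refine (((hasDerivAt_exp_mul_sq (β / 4) r).mul h2).mul (hasDerivAt_pow (2 * k) r)).congr_deriv ?_
    simp only [hΦ', Pi.mul_apply]
    ring
  have hΦ'c : Continuous Φ' := by
    simp only [hΦ']
    exact ((((((continuous_const.mul continuous_id).mul hEc).mul (hWc.pow 2)).mul
      (continuous_id.pow _)).add ((hEc.mul ((continuous_const.mul hWc).mul hW₁c)).mul
      (continuous_id.pow _))).add ((hEc.mul (hWc.pow 2)).mul (continuous_const.mul (continuous_id.pow _))))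
  have hftc : -(Real.exp (β / 4 * 4 ^ 2) * W 4 ^ 2 * 4 ^ (2 * k)) ≤ ∫ r in 4..b, Φ' r := by
    rw [integral_eq_sub_of_hasDerivAt (fun r _ => hΦ r) (hΦ'c.intervalIntegrable _ _)]
    have hbterm : 0 ≤ Real.exp (β / 4 * b ^ 2) * W b ^ 2 * b ^ (2 * k) := by
      have hb0 : (0 : ℝ) ≤ b := by linarith
      positivity
    linarith
  -- the pointwise inequality on `[4, b]`
  have hpt : ∀ r ∈ Icc 4 b, Φ' r + 1 / 8 * (Real.exp (β / 4 * r ^ 2) * W r ^ 2 * r ^ (2 * k + 1)) ≤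
      8 * (Real.exp (β / 4 * r ^ 2) * J r ^ 2 * r) := by
    intro r hr
    have hr0 : 0 < r := by linarith [hr.1]
    have hE0 : 0 < Real.exp (β / 4 * r ^ 2) := Real.exp_pos _
    have hP0 : 0 ≤ r ^ (2 * k) := by positivity
    have hPr : r ^ (2 * k + 1) = r ^ (2 * k) * r := by rw [pow_succ]
    have hP4 : r ^ (2 * k) ≤ r ^ 4 := pow_le_pow_right₀ (by linarith [hr.1]) (by omega)
    have hQ : ((2 * k : ℕ) : ℝ) * r ^ (2 * k - 1) * 16 ≤ ((2 * k : ℕ) : ℝ) * (r ^ (2 * k) * r) := by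
      rcases Nat.eq_zero_or_pos k with rfl | hk0
      · simp
      · have e : r ^ (2 * k) * r = r ^ (2 * k - 1) * r ^ 2 := by
          rw [← pow_succ, ← pow_add]
          congr 1
          omega
        rw [e]
        have h16 : (16 : ℝ) ≤ r ^ 2 := by nlinarith [hr.1]
        have h0 : (0 : ℝ) ≤ ((2 * k : ℕ) : ℝ) * r ^ (2 * k - 1) := by positivity
        calc ((2 * k : ℕ) : ℝ) * r ^ (2 * k - 1) * 16 ≤ ((2 * k : ℕ) : ℝ) * r ^ (2 * k - 1) * r ^ 2 :=
              mul_le_mul_of_nonneg_left h16 h0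
          _ = _ := by ring
    have hW₁ : W₁ r = (J r - r ^ 2 / 2 * W r) / r := by
      rw [hJ]
      field_simp
      ring
    -- (a) substitute `rW₁ = J − (r²/2) W`
    have ha : Real.exp (β / 4 * r ^ 2) * (2 * W r * W₁ r) * r ^ (2 * k) =
        2 * Real.exp (β / 4 * r ^ 2) * W r * J r * r ^ (2 * k) / r -
          Real.exp (β / 4 * r ^ 2) * W r ^ 2 * (r ^ (2 * k) * r) := by
      rw [hW₁]
      field_simp
    -- (b) Young's inequality for the cross term
    have hb' : 2 * Real.exp (β / 4 * r ^ 2) * W r * J r * r ^ (2 * k) / r ≤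
        1 / 8 * (Real.exp (β / 4 * r ^ 2) * W r ^ 2 * (r ^ (2 * k) * r)) +
          8 * (Real.exp (β / 4 * r ^ 2) * J r ^ 2 * r ^ (2 * k) / r ^ 3) := by
      have key : 0 ≤ Real.exp (β / 4 * r ^ 2) * r ^ (2 * k) * (W r * r ^ 2 - 8 * J r) ^ 2 / (8 * r ^ 3) := by
        positivity
      have e : 1 / 8 * (Real.exp (β / 4 * r ^ 2) * W r ^ 2 * (r ^ (2 * k) * r)) +
          8 * (Real.exp (β / 4 * r ^ 2) * J r ^ 2 * r ^ (2 * k) / r ^ 3) -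
          2 * Real.exp (β / 4 * r ^ 2) * W r * J r * r ^ (2 * k) / r =
          Real.exp (β / 4 * r ^ 2) * r ^ (2 * k) * (W r * r ^ 2 - 8 * J r) ^ 2 / (8 * r ^ 3) := by
        field_simp
        ring
      linarith
    -- (c) `r^{2k}/r³ ≤ r`
    have hc : Real.exp (β / 4 * r ^ 2) * J r ^ 2 * r ^ (2 * k) / r ^ 3 ≤
        Real.exp (β / 4 * r ^ 2) * J r ^ 2 * r := by
      rw [div_le_iff₀ (by positivity)]
      have h1 : Real.exp (β / 4 * r ^ 2) * J r ^ 2 * r ^ (2 * k) ≤ Real.exp (β / 4 * r ^ 2) * J r ^ 2 * r ^ 4 :=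
        mul_le_mul_of_nonneg_left hP4 (by positivity)
      calc _ ≤ Real.exp (β / 4 * r ^ 2) * J r ^ 2 * r ^ 4 := h1
        _ = _ := by ring
    -- (d) the lower-order term
    have hd : Real.exp (β / 4 * r ^ 2) * W r ^ 2 * (((2 * k : ℕ) : ℝ) * r ^ (2 * k - 1)) ≤
        (k : ℝ) / 8 * (Real.exp (β / 4 * r ^ 2) * W r ^ 2 * (r ^ (2 * k) * r)) := by
      have h1 : ((2 * k : ℕ) : ℝ) * r ^ (2 * k - 1) ≤ (k : ℝ) / 8 * (r ^ (2 * k) * r) := by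
        push_cast at hQ ⊢
        linarith
      have h2 := mul_le_mul_of_nonneg_left h1 (by positivity : 0 ≤ Real.exp (β / 4 * r ^ 2) * W r ^ 2)
      calc _ ≤ Real.exp (β / 4 * r ^ 2) * W r ^ 2 * ((k : ℝ) / 8 * (r ^ (2 * k) * r)) := h2
        _ = _ := by ring
    have hk' : (k : ℝ) ≤ 2 := by exact_mod_cast hk
    have hA0 : 0 ≤ Real.exp (β / 4 * r ^ 2) * W r ^ 2 * (r ^ (2 * k) * r) := by positivity
    have hβA : β * (Real.exp (β / 4 * r ^ 2) * W r ^ 2 * (r ^ (2 * k) * r)) ≤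
        Real.exp (β / 4 * r ^ 2) * W r ^ 2 * (r ^ (2 * k) * r) := mul_le_of_le_one_left hA0 hβ1
    have hkA : (k : ℝ) * (Real.exp (β / 4 * r ^ 2) * W r ^ 2 * (r ^ (2 * k) * r)) ≤
        2 * (Real.exp (β / 4 * r ^ 2) * W r ^ 2 * (r ^ (2 * k) * r)) := mul_le_mul_of_nonneg_right hk' hA0
    have hΦ'r : Φ' r = 2 * (β / 4) * r * Real.exp (β / 4 * r ^ 2) * W r ^ 2 * r ^ (2 * k) +
        Real.exp (β / 4 * r ^ 2) * (2 * W r * W₁ r) * r ^ (2 * k) +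
        Real.exp (β / 4 * r ^ 2) * W r ^ 2 * (((2 * k : ℕ) : ℝ) * r ^ (2 * k - 1)) := rfl
    have e1 : 2 * (β / 4) * r * Real.exp (β / 4 * r ^ 2) * W r ^ 2 * r ^ (2 * k) =
        β / 2 * (Real.exp (β / 4 * r ^ 2) * W r ^ 2 * (r ^ (2 * k) * r)) := by ring
    rw [hΦ'r, hPr, ha, e1]
    linarith [hb', hc, hd, hβA, hkA]
  -- integrate the pointwise inequality
  have hI : IntervalIntegrable (fun r => Real.exp (β / 4 * r ^ 2) * W r ^ 2 * r ^ (2 * k + 1)) volume 4 b :=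
    ((hEc.mul (hWc.pow 2)).mul (continuous_id.pow _)).intervalIntegrable _ _
  have hIJ : IntervalIntegrable (fun r => Real.exp (β / 4 * r ^ 2) * J r ^ 2 * r) volume 4 b :=
    ((hEc.mul (hJc.pow 2)).mul continuous_id).intervalIntegrable _ _
  have hmono : ∫ r in 4..b, (Φ' r + 1 / 8 * (Real.exp (β / 4 * r ^ 2) * W r ^ 2 * r ^ (2 * k + 1))) ≤
      ∫ r in 4..b, 8 * (Real.exp (β / 4 * r ^ 2) * J r ^ 2 * r) :=
    intervalIntegral.integral_mono_on hb ((hΦ'c.intervalIntegrable _ _).add (hI.const_mul _))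
      (hIJ.const_mul _) hpt
  rw [intervalIntegral.integral_add (hΦ'c.intervalIntegrable _ _) (hI.const_mul _),
    intervalIntegral.integral_const_mul, intervalIntegral.integral_const_mul] at hmono
  -- `∫₄ᵇ e J² r ≤ NJ`
  have hJ4 : ∫ r in 4..b, Real.exp (β / 4 * r ^ 2) * J r ^ 2 * r ≤ NJ := by
    refine le_trans ?_ hNJ
    refine intervalIntegral.integral_mono_interval (by norm_num) hb le_rfl ?_
      (((hEc.mul (hJc.pow 2)).mul continuous_id).intervalIntegrable _ _)
    filter_upwards [ae_restrict_mem measurableSet_Ioc] with s hs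
    exact mul_nonneg (mul_nonneg (Real.exp_pos _).le (sq_nonneg _)) hs.1.le
  -- `e^{4β} ≤ e⁴`
  have hE4 : Real.exp (β / 4 * 4 ^ 2) * W 4 ^ 2 * 4 ^ (2 * k) ≤ Real.exp 4 * 4 ^ (2 * k) * M2 := by
    have h1 : Real.exp (β / 4 * 4 ^ 2) ≤ Real.exp 4 := Real.exp_le_exp.2 (by nlinarith)
    calc Real.exp (β / 4 * 4 ^ 2) * W 4 ^ 2 * 4 ^ (2 * k) = Real.exp (β / 4 * 4 ^ 2) * 4 ^ (2 * k) * W 4 ^ 2 := by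
          ring
      _ ≤ Real.exp 4 * 4 ^ (2 * k) * M2 :=
          mul_le_mul (mul_le_mul_of_nonneg_right h1 (by positivity)) hM (sq_nonneg _) (by positivity)
  linarith



/-- **The one-variable radial bound from the centre identity** (variant of `radial_profile_bound`):
`0 < β ≤ 1`, `b ≥ 4`, `W' = W₁` continuous, `F` continuous, `J = rW₁ + (r²/2)W` with `J' = rF` on `[0, b]`,
`J(b) = 0` and the CENTRE IDENTITY `W(0) = −∫₀ᵇ (W₁ + (r/2)W)` (true for compactly supported mass-zero
profiles and for their corrections by mass-zero solutions with a Gaussian tail). Then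
`∫₀ᵇ e^{βr²/4} ((1 + r²) W² + r² W₁²) r ≤ (3·10⁵ e¹²/β²) ∫₀ᵇ e^{βr²/4} F² r`. [folklore] -/
theorem radial_profile_bound_of_center {β : ℝ} (hβ : 0 < β) (hβ1 : β ≤ 1) {b : ℝ} (hb : 4 ≤ b)
    {W W₁ F J : ℝ → ℝ} (hW : ∀ r, HasDerivAt W (W₁ r) r) (hW₁c : Continuous W₁) (hFc : Continuous F)
    (hJ : ∀ r, J r = r * W₁ r + r ^ 2 / 2 * W r) (hJ' : ∀ r ∈ Icc 0 b, HasDerivAt J (r * F r) r)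
    (hJb : J b = 0) (h0 : W 0 = -∫ r in 0..b, (W₁ r + r / 2 * W r)) :
    ∫ r in 0..b, Real.exp (β / 4 * r ^ 2) * ((1 + r ^ 2) * W r ^ 2 + r ^ 2 * W₁ r ^ 2) * r ≤
      300000 * Real.exp 12 / β ^ 2 * ∫ r in 0..b, Real.exp (β / 4 * r ^ 2) * F r ^ 2 * r := by
  have hb0 : (0 : ℝ) ≤ b := by linarith
  have hb1 : (1 : ℝ) ≤ b := by linarith
  have hWc : Continuous W := continuous_iff_continuousAt.2 fun r => (hW r).continuousAt
  have hEc : Continuous fun r : ℝ => Real.exp (β / 4 * r ^ 2) :=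
    Real.continuous_exp.comp (continuous_const.mul (continuous_id.pow 2))
  have hJc : Continuous J := by
    rw [show J = fun r => r * W₁ r + r ^ 2 / 2 * W r from funext hJ]
    exact (continuous_id.mul hW₁c).add (((continuous_id.pow 2).div_const 2).mul hWc)
  have hJ0 : J 0 = 0 := by rw [hJ]; ring
  set N := ∫ r in 0..b, Real.exp (β / 4 * r ^ 2) * F r ^ 2 * r with hN
  set NJ := ∫ r in 0..b, Real.exp (β / 4 * r ^ 2) * J r ^ 2 * r with hNJ
  have hN0 : 0 ≤ N := intervalIntegral.integral_nonneg hb0 fun r hr =>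
    mul_nonneg (mul_nonneg (Real.exp_pos _).le (sq_nonneg _)) hr.1
  have hNJ0 : 0 ≤ NJ := intervalIntegral.integral_nonneg hb0 fun r hr =>
    mul_nonneg (mul_nonneg (Real.exp_pos _).le (sq_nonneg _)) hr.1
  -- the four one-variable estimates
  have hHardy : NJ ≤ 16 / β ^ 2 * N := radial_hardy_flux hβ hb0 hJc hFc hJ' hJ0 hJb
  have hJsq : ∀ r ∈ Icc 0 b, J r ^ 2 ≤ r ^ 2 / 2 * N := fun r hr =>
    radial_flux_sq_le hβ.le hFc hJ' hJ0 hr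
  have hW0 : W 0 ^ 2 ≤ N + 2 * NJ := radial_center_sq_le_of_center hβ.le hb1 hW hW₁c hJc hJ hJsq h0
  set M2 := 2 * W 0 ^ 2 + 16 * Real.exp 8 * N with hM2
  have hnear : ∀ r ∈ Icc 0 4, W r ^ 2 ≤ M2 := fun r hr => radial_near_sq_le hb hW hW₁c hJ hJsq hr
  have hM20 : 0 ≤ M2 := by positivity
  -- integrability of the moment integrands
  have hIk : ∀ (k : ℕ) (u v : ℝ), IntervalIntegrable
      (fun r => Real.exp (β / 4 * r ^ 2) * W r ^ 2 * r ^ (2 * k + 1)) volume u v := fun k u v =>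
    ((hEc.mul (hWc.pow 2)).mul (continuous_id.pow _)).intervalIntegrable _ _
  -- near-field moments
  have hnearI : ∀ k : ℕ, ∫ r in 0..4, Real.exp (β / 4 * r ^ 2) * W r ^ 2 * r ^ (2 * k + 1) ≤
      4 * (Real.exp 4 * M2 * 4 ^ (2 * k + 1)) := by
    intro k
    have h := intervalIntegral.integral_mono_on (by norm_num : (0 : ℝ) ≤ 4) (hIk k 0 4)
      (intervalIntegrable_const (c := Real.exp 4 * M2 * 4 ^ (2 * k + 1))) fun r hr => by
        have h1 : Real.exp (β / 4 * r ^ 2) ≤ Real.exp 4 := Real.exp_le_exp.2 (by nlinarith [hr.1, hr.2])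
        have h2 : W r ^ 2 ≤ M2 := hnear r hr
        have h3 : r ^ (2 * k + 1) ≤ 4 ^ (2 * k + 1) := pow_le_pow_left₀ hr.1 hr.2 _
        exact mul_le_mul (mul_le_mul h1 h2 (sq_nonneg _) (Real.exp_pos _).le) h3
          (by have := hr.1; positivity) (by positivity)
    rw [intervalIntegral.integral_const, sub_zero, smul_eq_mul] at h
    exact h
  -- far-field moments
  have hfarI : ∀ k : ℕ, k ≤ 2 → ∫ r in 4..b, Real.exp (β / 4 * r ^ 2) * W r ^ 2 * r ^ (2 * k + 1) ≤
      8 * Real.exp 4 * 4 ^ (2 * k) * M2 + 64 * NJ := fun k hk =>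
    radial_far_le' hβ1 hb hW hW₁c hJc hJ le_rfl (hnear 4 ⟨by norm_num, le_rfl⟩) hk
  have hT : ∀ k : ℕ, k ≤ 2 → ∫ r in 0..b, Real.exp (β / 4 * r ^ 2) * W r ^ 2 * r ^ (2 * k + 1) ≤
      4 * (Real.exp 4 * M2 * 4 ^ (2 * k + 1)) + (8 * Real.exp 4 * 4 ^ (2 * k) * M2 + 64 * NJ) := by
    intro k hk
    rw [← intervalIntegral.integral_add_adjacent_intervals (hIk k 0 4) (hIk k 4 b)]
    exact add_le_add (hnearI k) (hfarI k hk)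
  have hT0 := hT 0 (by norm_num); have hT1 := hT 1 (by norm_num); have hT2 := hT 2 (by norm_num)
  norm_num only at hT0 hT1 hT2
  -- the gradient term through the flux: `r² W₁² ≤ 2 J² + r⁴ W²/2`
  have hIW₁ : IntervalIntegrable (fun r => Real.exp (β / 4 * r ^ 2) * (r ^ 2 * W₁ r ^ 2) * r) volume 0 b :=
    ((hEc.mul ((continuous_id.pow 2).mul (hW₁c.pow 2))).mul continuous_id).intervalIntegrable _ _
  have hIJ : IntervalIntegrable (fun r => Real.exp (β / 4 * r ^ 2) * J r ^ 2 * r) volume 0 b :=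
    ((hEc.mul (hJc.pow 2)).mul continuous_id).intervalIntegrable _ _
  have hW₁I : ∫ r in 0..b, Real.exp (β / 4 * r ^ 2) * (r ^ 2 * W₁ r ^ 2) * r ≤
      2 * NJ + 1 / 2 * ∫ r in 0..b, Real.exp (β / 4 * r ^ 2) * W r ^ 2 * r ^ (2 * 2 + 1) := by
    have h := intervalIntegral.integral_mono_on hb0 hIW₁ ((hIJ.const_mul 2).add ((hIk 2 0 b).const_mul _))
      fun r hr => by
        have e : r * W₁ r = J r - r ^ 2 / 2 * W r := by rw [hJ]; ring
        have h0 : 0 ≤ Real.exp (β / 4 * r ^ 2) * r := mul_nonneg (Real.exp_pos _).le hr.1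
        have h1 : r ^ 2 * W₁ r ^ 2 ≤ 2 * J r ^ 2 + 1 / 2 * (W r ^ 2 * r ^ 4) := by
          have : r ^ 2 * W₁ r ^ 2 = (J r - r ^ 2 / 2 * W r) ^ 2 := by rw [← e]; ring
          rw [this]
          nlinarith [sq_nonneg (J r + r ^ 2 / 2 * W r)]
        have h2 := mul_le_mul_of_nonneg_left h1 h0
        have e2 : Real.exp (β / 4 * r ^ 2) * r * (2 * J r ^ 2 + 1 / 2 * (W r ^ 2 * r ^ 4)) =
            2 * (Real.exp (β / 4 * r ^ 2) * J r ^ 2 * r) +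
              1 / 2 * (Real.exp (β / 4 * r ^ 2) * W r ^ 2 * r ^ (2 * 2 + 1)) := by ring
        calc Real.exp (β / 4 * r ^ 2) * (r ^ 2 * W₁ r ^ 2) * r
            = Real.exp (β / 4 * r ^ 2) * r * (r ^ 2 * W₁ r ^ 2) := by ring
          _ ≤ _ := h2
          _ = _ := e2
    rw [intervalIntegral.integral_add (hIJ.const_mul 2) ((hIk 2 0 b).const_mul _),
      intervalIntegral.integral_const_mul, intervalIntegral.integral_const_mul] at h
    exact h
  norm_num only at hW₁I
  -- decomposition of the left-hand side
  have hLHS : ∫ r in 0..b, Real.exp (β / 4 * r ^ 2) * ((1 + r ^ 2) * W r ^ 2 + r ^ 2 * W₁ r ^ 2) * r =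
      ((∫ r in 0..b, Real.exp (β / 4 * r ^ 2) * W r ^ 2 * r ^ 1) +
        ∫ r in 0..b, Real.exp (β / 4 * r ^ 2) * W r ^ 2 * r ^ 3) +
        ∫ r in 0..b, Real.exp (β / 4 * r ^ 2) * (r ^ 2 * W₁ r ^ 2) * r := by
    rw [← intervalIntegral.integral_add (hIk 0 0 b) (hIk 1 0 b), ← intervalIntegral.integral_add
      ((hIk 0 0 b).add (hIk 1 0 b)) hIW₁]
    exact intervalIntegral.integral_congr fun r _ => by ring
  rw [hLHS]
  -- bookkeeping of the constants
  set K := Real.exp 12 with hK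
  set n := N / β ^ 2 with hn
  have hβ2 : β ^ 2 ≤ 1 := by nlinarith
  have hβ20 : 0 < β ^ 2 := by positivity
  have hn0 : 0 ≤ n := by positivity
  have hNn : N ≤ n := by
    rw [hn, le_div_iff₀ hβ20]
    nlinarith
  have hNJn : NJ ≤ 16 * n := by rw [hn]; linarith [hHardy, show 16 / β ^ 2 * N = 16 * (N / β ^ 2) by ring]
  have he4 : Real.exp 4 ≤ K := Real.exp_le_exp.2 (by norm_num)
  have hK1 : 1 ≤ K := Real.one_le_exp (by norm_num)
  have he40 : 0 ≤ Real.exp 4 := (Real.exp_pos 4).le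
  have he48 : Real.exp 4 * Real.exp 8 = K := by rw [hK, ← Real.exp_add]; norm_num
  have hM2' : Real.exp 4 * M2 ≤ 2 * (Real.exp 4 * N) + 4 * (Real.exp 4 * NJ) + 16 * (K * N) := by
    have h1 : M2 ≤ 2 * N + 4 * NJ + 16 * Real.exp 8 * N := by rw [hM2]; linarith
    have h2 := mul_le_mul_of_nonneg_left h1 he40
    calc Real.exp 4 * M2 ≤ Real.exp 4 * (2 * N + 4 * NJ + 16 * Real.exp 8 * N) := h2
      _ = 2 * (Real.exp 4 * N) + 4 * (Real.exp 4 * NJ) + 16 * (Real.exp 4 * Real.exp 8 * N) := by ring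
      _ = _ := by rw [he48]
  have p1 : Real.exp 4 * N ≤ K * n := mul_le_mul he4 hNn hN0 (by positivity)
  have p2 : Real.exp 4 * NJ ≤ K * (16 * n) := mul_le_mul he4 hNJn hNJ0 (by positivity)
  have p3 : K * N ≤ K * n := mul_le_mul_of_nonneg_left hNn (by positivity)
  have p4 : n ≤ K * n := le_mul_of_one_le_left hn0 hK1
  have hgoal : 300000 * Real.exp 12 / β ^ 2 * N = 300000 * (K * n) := by
    rw [hK, hn]
    ring
  rw [hgoal]
  linarith [hT0, hT1, hT2, hW₁I, hM2', p1, p2, p3, p4, hNJn]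



end Summit.NavierStokesRegularity.NavierStokesRegularity.Theorems
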